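import Summits.BirchSwinnertonDyer.BirchSwinnertonDyer.Theorems.AlignedTransportAtTwoMainConjectureOfRankZeroBSDAtTwoOrdinaryCMExclusion
import Summits.BirchSwinnertonDyer.Rank1Residual.X5.TwoAdicInstancesToolkitB
import Summits.BirchSwinnertonDyer.Rank1Residual.X5.TwoAdicInstancesToolkitD
import HarnessLib

/-!
# Route `AlignedTransportAtTwo`, crux C2 `MainConjectureOfRankZeroBSDAtTwo` (stmt-BirchSwinnertonDyer-22298):
# THE CM EXCLUSION IS SHARP — the CM curve `49a1` is globally minimal, good ORDINARY at `2`, `Δ = −7³ ∉ ℚ²`,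
# and carries the rational `2`-torsion point `(2, −1)`; so the `W(ℚ)[2] = 0` binder of `cmExclusion` cannot be dropped

HONEST FRAMING. WIDTH-5 attached prover seat `bsd-line-att-p4` g37 on line `birth` of the lead `bsd-line-att-p2` (WAKE-only);
`--supports` stmt-BirchSwinnertonDyer-22298 `--as helper`, closes nothing; BSD is NOT proved; crux C2 and every registered stub untouched.
THEOREMS ONLY, all UNCONDITIONAL and kernel-decided (A3/A5 evidence for REF1 on this seat's `…OrdinaryCMExclusion.cmExclusion`):

* §0 `isOrdinaryAt_two_of_hasGoodReductionAtPrime_two_of_j_eq_intCast_odd`, `isOrdinaryAt_two_iff_odd_of_j_eq_intCast` — the converse of A's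
  `odd_of_isOrdinaryAt_two_of_j_eq_intCast`: for a globally minimal `W` good at `2` with `j = n ∈ ℤ`, ORDINARY at `2` ⟺ `n` odd (dictionary entry).

* §1 the record `49a1 = [1, −1, 0, −2, −1]` (Cremona): `Δ = −343`, `c₄ = 105`, `j = −3375`, globally minimal (Silverman VII.1 Remark 1.1 at
  the prime `7` of `gcd(Δ, c₄) = 7`), `#Ẽ(𝔽₂) = 2` hence good ORDINARY at `2` (`a₂ = 1`), CM (`j ∈ cmJInvariants`, `hasCM_iff_j_mem_holds`),
  `Δ < 0` hence `Δ ∉ ℚ²`, and `HasRationalTwoTorsionX 49a1 2` (the point `(2, −1)` of order `2`).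
* §2 ★★ `not_cmExclusion_without_twoTorsion` — the strengthening of `cmExclusion` WITHOUT the binder «`∀ x, ¬ HasRationalTwoTorsionX W x`» is
  FALSE; ★ `exists_hasCM_isOrdinaryAt_two_not_isSquare` — the A3 witness packaged. (So the `¬ W.HasCM` binder of the WALL row
  `Theses.ByReductionTypeAtTwo.GoodOrdinaryRankZeroAtTwo`, which has no `2`-torsion binder, is NOT idle by this route — `49a1` has `r_an = 0`.)

References: [CremonaAlgorithms1997] Table 1 (`49a1`, torsion `ℤ/2`); [SilvermanAEC2009] VII.1 Remark 1.1, VII.5 Prop. 5.1(a), App. C §11;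
tree: `…OrdinaryCMExclusion` (this seat), `Rank1Residual/X5/TwoAdicInstancesToolkit{,B,D}` (bsd-2adic-ord), `X11RankOneCertificates/Minimality`.
-/

set_option autoImplicit false
-- the Theorems namespace of this sub repeats the summit name by design (D-0017 nested layout)
set_option linter.dupNamespace false

noncomputable section

open scoped Classical

namespace Summit.BirchSwinnertonDyer.BirchSwinnertonDyer.Theorems.AlignedTransportAtTwoOrdinaryCMExclusionSharp

open WeierstrassCurve Literature.NumberTheory.EllipticCurves Literature.NumberTheory.EllipticCurves.Greenberg1999
  Literature.NumberTheory.EllipticCurves.Rank1Residual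
  Summit.BirchSwinnertonDyer.Rank1Residual.X5.Instances
  Summit.BirchSwinnertonDyer.BirchSwinnertonDyer.Theorems.AlignedTransportAtTwoOrdinaryCMExclusion

/-! ## §0 For an integral `j`, ordinarity at `2` is the parity of `j` -/

/-- **Converse of `odd_of_isOrdinaryAt_two_of_j_eq_intCast`.** On a globally minimal elliptic `W/ℚ` with good reduction at `2` and
`j = n ∈ ℤ` ODD: `W` is ordinary at `2` (`n·Δ_min = c₄³` with `Δ_min` odd forces `c₄` odd, hence `a₁` odd — `PrimeConductorTwoTorsion.odd_a₁_of_odd_c₄`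
— hence ordinary, `isOrdinaryAt_two_iff_odd_a₁`). [cite: SilvermanAEC2009, V.4 (first paragraph) and VII.5 Prop. 5.1(a)] -/
theorem isOrdinaryAt_two_of_hasGoodReductionAtPrime_two_of_j_eq_intCast_odd (W : WeierstrassCurve ℚ) [W.IsElliptic] [W.IsGloballyMinimal]
    (hgood : W.HasGoodReductionAtPrime 2) {n : ℤ} (hj : W.j = n) (hn : Odd n) : IsOrdinaryAt W 2 := by
  have hΔ : Odd (minimalDiscriminantInt W) :=
    Summit.BirchSwinnertonDyer.BirchSwinnertonDyer.Theorems.ResidualThetaHabitatAtTwo.odd_minimalDiscriminantInt_of_hasGoodReductionAtPrime_two W hgood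
  have hΔ0 : W.Δ ≠ 0 := W.isUnit_Δ.ne_zero
  rw [WeierstrassCurve.j, Units.val_inv_eq_inv_val, coe_Δ'] at hj
  have hc : W.c₄ ^ 3 = n * W.Δ := by
    rw [← hj]; field_simp
  rw [← Summit.BirchSwinnertonDyer.BirchSwinnertonDyer.Theorems.OrdinaryTwistAtTwo.intCast_c₄_integralModelInt,
    ← cast_minimalDiscriminantInt] at hc
  have hcz : (integralModelInt W).c₄ ^ 3 = n * minimalDiscriminantInt W := by exact_mod_cast hc
  have hc₄ : Odd (integralModelInt W).c₄ :=
    (Int.odd_pow' three_ne_zero).mp (hcz ▸ Int.odd_mul.mpr ⟨hn, hΔ⟩)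
  exact (Summit.BirchSwinnertonDyer.BirchSwinnertonDyer.Theorems.OrdinaryTwistAtTwo.isOrdinaryAt_two_iff_odd_a₁ W hgood).mpr
    (PrimeConductorTwoTorsion.odd_a₁_of_odd_c₄ _ hc₄)

/-- **For an integral `j`, good ORDINARY reduction at `2` ⟺ good reduction at `2` and `j` odd** (a globally minimal elliptic `W/ℚ` with `j = n ∈ ℤ`).
Dictionary entry for census seats: among the thirteen CM `j`, exactly `−3375` and `16581375` are odd. [cite: SilvermanAEC2009, V.4 and VII.5 Prop. 5.1(a)] -/
theorem isOrdinaryAt_two_iff_odd_of_j_eq_intCast (W : WeierstrassCurve ℚ) [W.IsElliptic] [W.IsGloballyMinimal]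
    (hgood : W.HasGoodReductionAtPrime 2) {n : ℤ} (hj : W.j = n) : IsOrdinaryAt W 2 ↔ Odd n :=
  ⟨fun hord ↦ odd_of_isOrdinaryAt_two_of_j_eq_intCast W hord hj,
    isOrdinaryAt_two_of_hasGoodReductionAtPrime_two_of_j_eq_intCast_odd W hgood hj⟩

/-! ## §1 The CM curve `49a1` — kernel-decided data -/

/-- Cremona's minimal model of `49a1` (`= X₀(49)`, CM by `ℤ[(1+√−7)/2]`). [cite: CremonaAlgorithms1997, Table 1] -/
abbrev M49a1 : WeierstrassCurve ℤ := ⟨1, -1, 0, -2, -1⟩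
/-- `49a1 / ℚ`. [cite: CremonaAlgorithms1997, Table 1] -/
abbrev c49a1 : WeierstrassCurve ℚ := M49a1.baseChange ℚ
/-- `Δ(49a1) = −343 = −7³`. [cite: CremonaAlgorithms1997, Table 1] -/
theorem M49a1_Δ : M49a1.Δ = -343 := by decide
/-- `c₄(49a1) = 105`. [cite: CremonaAlgorithms1997, Table 1] -/
theorem M49a1_c₄ : M49a1.c₄ = 105 := by decide
/-- `49a1` is an elliptic curve. [cite: CremonaAlgorithms1997, Table 1] -/
instance c49a1_isElliptic : c49a1.IsElliptic := by
  rw [WeierstrassCurve.isElliptic_iff, baseChange_int_Δ, M49a1_Δ]; norm_num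
/-- Cremona's model `49a1` is globally minimal: Silverman VII.1 Remark 1.1 at the prime `7` of `gcd(Δ, c₄) = 7` (`ord₇ Δ = 3 < 12`).
[cite: SilvermanAEC2009, VII.1 Remark 1.1] -/
instance c49a1_isGloballyMinimal : c49a1.IsGloballyMinimal := by
  rw [c49a1, baseChange_int_eq]
  refine X11RankOneCertificates.isGloballyMinimal_of_int_criterion 1 (-1) 0 (-2) (-1)
    (int_criterion_of_primeFactors_gcd (by decide) ?_)
  have hg : (Int.gcd (X11RankOneCertificates.discOf [1, -1, 0, -2, -1])
      (X11RankOneCertificates.c4Of [1, -1, 0, -2, -1])).primeFactors = {7} := by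
    rw [show Int.gcd (X11RankOneCertificates.discOf [1, -1, 0, -2, -1])
      (X11RankOneCertificates.c4Of [1, -1, 0, -2, -1]) = 7 by decide]
    exact Nat.Prime.primeFactors (by norm_num)
  rw [hg]; decide
/-- `49a1 mod 2 = [1, 1, 0, 0, 1]`. [folklore] -/
theorem M49a1_mod_two : M49a1.map (Int.castRingHom (ZMod 2)) = ⟨1, 1, 0, 0, 1⟩ := by
  ext <;> decide
/-- `#Ẽ(𝔽₂) = 2` for `49a1` (`a₂(49a1) = 1`). [cite: CremonaAlgorithms1997, Table 1] -/
theorem M49a1_card_two : Nat.card (M49a1.map (Int.castRingHom (ZMod 2))).toAffine.Point = 2 := by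
  rw [M49a1_mod_two, natCard_point_eq_one_add_card _ (by decide)]; decide
/-- **`49a1` has good ORDINARY reduction at `2`** (`#Ẽ(𝔽₂) = 2`, `a₂ = 1`; `2` splits in `ℚ(√−7)`). [cite: SilvermanAEC2009, VII.5 Prop. 5.1(a)] -/
theorem goodOrd_two_49a1 : GoodOrd c49a1 2 :=
  goodOrd_two_baseChange_int_of_card_two M49a1 (by rw [M49a1_Δ]; decide) M49a1_card_two
/-- `49a1` is good ordinary at `2` in `IsOrdinaryAt` currency. [cite: SilvermanAEC2009, VII.5 Prop. 5.1(a)] -/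
theorem isOrdinaryAt_two_49a1 : IsOrdinaryAt c49a1 2 :=
  ⟨goodOrd_two_49a1.1, goodOrd_two_49a1.2⟩
/-- `j(49a1) = −3375 = −15³`. [cite: CremonaAlgorithms1997, Table 1] [cite: SilvermanAEC2009, App. C §11] -/
theorem j_49a1 : c49a1.j = -3375 := by
  have hc₄ : c49a1.c₄ = 105 := by
    rw [show c49a1 = M49a1.map (algebraMap ℤ ℚ) from rfl, map_c₄, M49a1_c₄]; norm_num
  rw [WeierstrassCurve.j, Units.val_inv_eq_inv_val, coe_Δ', baseChange_int_Δ, M49a1_Δ, hc₄]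
  norm_num
/-- **`49a1` has complex multiplication** (`j = −3375 ∈ cmJInvariants`; tree theorem `hasCM_iff_j_mem_holds`).
[cite: SilvermanAEC2009, App. C §11 Examples 11.3.1–11.3.2] -/
theorem hasCM_49a1 : c49a1.HasCM :=
  (hasCM_iff_j_mem_holds c49a1).mpr (by rw [j_49a1]; simp [cmJInvariants])
/-- `Δ(49a1) = −343` is not a square in `ℚ` (it is negative). [folklore] -/
theorem not_isSquare_Δ_49a1 : ¬ IsSquare c49a1.Δ := by
  rw [baseChange_int_Δ, M49a1_Δ]
  push_cast
  rintro ⟨r, hr⟩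
  nlinarith [mul_self_nonneg r]
/-- **`(2, −1)` is a rational point of order `2` on `49a1`**: `HasRationalTwoTorsionX 49a1 2`. [cite: CremonaAlgorithms1997, Table 1 (torsion ℤ/2)] -/
theorem hasRationalTwoTorsionX_49a1 : HasRationalTwoTorsionX c49a1 2 := by
  refine ⟨-1, ?_, ?_⟩
  · rw [c49a1, baseChange_int_eq, WeierstrassCurve.Affine.equation_iff]
    norm_num
  · rw [c49a1, baseChange_int_eq]
    norm_num

/-! ## §2 Sharpness of the CM exclusion -/

/-- ★★ **The CM exclusion is SHARP in its `2`-torsion binder**: «globally minimal, good ordinary at `2`, `Δ ∉ ℚ²` ⟹ `¬CM`» is FALSE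
(witness `49a1`). So in `…OrdinaryCMExclusion.cmExclusion` the binder `∀ x, ¬ HasRationalTwoTorsionX W x` carries the weight (and the `Δ`
binder none). [cite: CremonaAlgorithms1997, Table 1] [cite: SilvermanAEC2009, App. C §11] -/
theorem not_cmExclusion_without_twoTorsion :
    ¬ (∀ (W : WeierstrassCurve ℚ) [W.IsElliptic] [W.IsGloballyMinimal], IsOrdinaryAt W 2 → ¬ IsSquare W.Δ → ¬ W.HasCM) :=
  fun h ↦ h c49a1 isOrdinaryAt_two_49a1 not_isSquare_Δ_49a1 hasCM_49a1

/-- ★ **A3 witness**: a globally minimal CM elliptic curve over `ℚ`, good ordinary at `2`, with `Δ ∉ ℚ²` — and, as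
`exists_hasRationalTwoTorsionX_of_hasCM_of_isOrdinaryAt_two` predicts, with a rational point of order `2` (abscissa `2`).
[cite: CremonaAlgorithms1997, Table 1] [cite: SilvermanAEC2009, App. C §11] -/
theorem exists_hasCM_isOrdinaryAt_two_not_isSquare :
    ∃ (W : WeierstrassCurve ℚ) (_ : W.IsElliptic) (_ : W.IsGloballyMinimal),
      W.HasCM ∧ IsOrdinaryAt W 2 ∧ ¬ IsSquare W.Δ ∧ HasRationalTwoTorsionX W 2 :=
  ⟨c49a1, inferInstance, inferInstance, hasCM_49a1, isOrdinaryAt_two_49a1, not_isSquare_Δ_49a1, hasRationalTwoTorsionX_49a1⟩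

end Summit.BirchSwinnertonDyer.BirchSwinnertonDyer.Theorems.AlignedTransportAtTwoOrdinaryCMExclusionSharp

end
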